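import Literature.AlgebraicGeometry.Resolution.ExtAnnihilatorAffineGlobal
import Literature.AlgebraicGeometry.Resolution.GenericCohenMacaulayAffine
import Literature.AlgebraicGeometry.Resolution.CohenMacaulaySystemsOfParameters
import Mathlib.RingTheory.Regular.ProjectiveDimension
import Mathlib.AlgebraicGeometry.Morphisms.FiniteType
import HarnessLib

/-!
# The Cohen–Macaulay locus of a scheme locally of finite type over a field is open — proofs

Topic: `Literature/AlgebraicGeometry/Resolution`. This file PROVES the statement of the named fact
`EGAIV2_cohenMacaulayLocusOpen` (`CohenMacaulayLocusOpen.lean`): EGA IV₂ Cor. (6.11.3) with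
Prop. (6.11.2) for `𝓕 = 𝒪_X` and `X` locally of finite type over a field `k` — the set of points
`x` at which every system of parameters of `𝒪_{X,x}` is a weakly regular sequence (i.e. `𝒪_{X,x}`
is Cohen–Macaulay, Matsumura Thm. 17.4 (iii) / `CohenMacaulaySystemsOfParameters.lean`) is open.
The discharge `EGAIV2_cohenMacaulayLocusOpen_holds` is the one-line append to the fact file; no
definition and no new named fact is introduced here.

## The proof (Auslander's projective-dimension argument behind EGA IV₂ (6.11.1)–(6.11.2), run on
## the tree's `Ext`-annihilator library)

Fix a regular affine `k`-domain `B` of dimension `n` (for the theorem, `B = k[x₁,…,xₙ]`), an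
ideal `I`, `A = B/I`, and ONE free resolution of finite type `F` of the `B`-module `A`
(`SyzygySheaf.lean`), with its cohomology modules `E^q(F) ≅ Ext^q_B(A, B)`
(`SyzygyStaircase.lean`). For a prime `𝔓` of `A` over `𝔭 = 𝔓 ∩ B` write `n' = ht 𝔭 = dim B_𝔭`,
`d' = dim A_𝔓` and `c(𝔓) = n' - d'` (the codimension of `Spec A` in `Spec B` at `𝔓`).

* (Theorem A, ALREADY IN THE TREE — `SecantColonAnnihilatorCMClause.cmClause_of_prod_annihilator_EMod_eq_top`,
  `ExtAnnihilatorAffineGlobal.lean`): if `E^q(F)_𝔭 = 0` for all `q ∈ (c(𝔓), max n' 2]` then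
  `A_𝔓` is Cohen–Macaulay.
* §1 `hasProjectiveDimensionLE_of_cmClause` — **Auslander–Buchsbaum, the inequality for
  Cohen–Macaulay quotients**: for a surjection `S ↠ T` of local rings, `S` regular of dimension
  `n'`, `T` Cohen–Macaulay of dimension `d'`, `pd_S T ≤ n' - d'` (lift a maximal `T`-regular
  sequence to `𝔪_S`; Mathlib's `ModuleCat.projectiveDimension_quotient_eq_add_length_of_isWeaklyRegular`
  and `gl.dim S = n'`, `RegularLocalRingsProofs.hasProjectiveDimensionLE_length_of_isWeaklyRegular`).
* §2 `not_annihilator_EMod_le_of_cmClause` — hence at a Cohen–Macaulay point `𝔓` the localized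
  syzygies `(K_{q-1})_𝔭`, `q > c(𝔓)`, are projective and `Ann_B E^q(F) ⊄ 𝔭`
  (`ExtAnnihilatorSupport.annihilator_EMod_not_le`): the converse of Theorem A at a point.
* §3 heights: `height_head_add_length_le_height_last` (series), and for the minimal primes `Q` of
  `I` below `𝔭`: `ht_A 𝔓 + ht_B Q ≤ ht_B 𝔭` for some such `Q` (`exists_minimalPrimes_height_add_le`,
  any Noetherian `B`) and `ht_B 𝔭 ≤ ht_B Q + ht_A 𝔓` for all such `Q`
  (`height_underPrime_le_height_add`, dimension formula for affine domains,
  `Literature.RingTheory.KrullDimension.ringKrullDim_quotient_add_height`). Consequently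
  `c(𝔓) = min {ht Q : Q ∈ Min(I), Q ⊆ 𝔭}` is lower semicontinuous.
* §4 `isOpen_setOf_cmClause_quotient` — **the affine heart**: a Cohen–Macaulay point `𝔓₀` has
  the open neighbourhood
  `{𝔓 : Ann E^q(F) ⊄ 𝔭 for c(𝔓₀) < q ≤ max n 2} ∩ {𝔓 : every Q ∈ Min(I) below 𝔭 lies below 𝔭₀}`
  of Cohen–Macaulay points (§2 puts `𝔓₀` inside; for `𝔓` inside, §3 gives `c(𝔓) ≥ c(𝔓₀)`, so
  the `Ext`-annihilator ideal of `F ⊗ B_𝔭` over `(c(𝔓), max n' 2]` is the unit ideal and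
  Theorem A applies).
* §5 `isOpen_setOf_cmClause` (any `k`-algebra of finite type, by a presentation
  `A ≅ k[x₁,…,xₙ]/I`; local rings at corresponding primes are isomorphic) and
  `EGAIV2_cohenMacaulayLocusOpen_proof` (schemes locally of finite type over `k`: affine locally
  `U ≅ Spec Γ(X, U)` is a homeomorphism and `𝒪_{X,x}` is the localization of `Γ(X, U)`,
  `IsAffineOpen.isLocalization_stalk`).

EGA proves (6.11.2) for `X` locally embeddable in a regular scheme via Auslander's upper
semicontinuity of `x ↦ coprof 𝓕ₓ = pd_{𝒪_{Y,x}} 𝓕ₓ - codim`; the argument above is that proof for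
the embedding `Spec A ⊂ Spec k[x₁,…,xₙ]`, with "`pd ≤ c` is an open condition" expressed through the
finitely many finite modules `E^q(F)` of one global resolution.

## References

* [EGAIV2] A. Grothendieck, J. Dieudonné, *Éléments de géométrie algébrique IV₂*, Publ. Math.
  IHÉS 24 (1965), Prop. (6.11.1), Prop. (6.11.2), Cor. (6.11.3) (pp. 159–160), (5.8.3).
* [BrunsHerzog1998] W. Bruns, J. Herzog, *Cohen–Macaulay rings*, Thm. 1.3.3 (Auslander–Buchsbaum),
  Thm. 2.1.2, Thm. 8.1.1 and the proof of Thm. 8.1.2.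
* [Matsumura1987] H. Matsumura, *Commutative Ring Theory*, Thm. 5.6 (dimension formula),
  Thm. 17.4 (iii), Thm. 19.2, Thm. 24.5 (Nagata's criterion (NC) holds for `P = CM`) with
  Exercise 24.2 (`CM(A)` is open in `Spec A` for `A` a quotient of a Cohen–Macaulay ring).
-/

noncomputable section

open CategoryTheory IsLocalRing Module RingTheory.Sequence

universe u

namespace Literature.AlgebraicGeometry.Resolution

/-! ## §1. Cohen–Macaulay quotients of a regular local ring have projective dimension `≤ codim` -/

section PdBound

variable {S T : Type u} [CommRing S] [IsRegularLocalRing S] [CommRing T] [IsLocalRing T]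
  [Algebra S T]

/-- Arithmetic in `WithBot ℕ∞`: `x + d ≤ n` with `d n : ℕ` forces `x ≤ n - d`. [folklore] -/
private theorem withBot_enat_le_sub_of_add_le {x : WithBot ℕ∞} {d n : ℕ}
    (h : x + (d : WithBot ℕ∞) ≤ (n : WithBot ℕ∞)) : x ≤ ((n - d : ℕ) : WithBot ℕ∞) := by
  induction x with
  | bot => exact bot_le
  | coe a =>
    induction a with
    | top =>
      exfalso
      have h' : ((⊤ : ℕ∞) : WithBot ℕ∞) + (d : WithBot ℕ∞) = ((⊤ : ℕ∞) : WithBot ℕ∞) := by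
        rw [← WithBot.coe_natCast, ← WithBot.coe_add, top_add]
      rw [h'] at h
      have h'' : (⊤ : ℕ∞) ≤ (n : ℕ∞) := by exact_mod_cast h
      exact ENat.coe_ne_top n (top_le_iff.mp h'')
    | coe m =>
      have h' : ((m + d : ℕ) : WithBot ℕ∞) ≤ (n : WithBot ℕ∞) := by
        have : (((m : ℕ∞) : WithBot ℕ∞) + (d : WithBot ℕ∞)) = ((m + d : ℕ) : WithBot ℕ∞) := by
          push_cast; rfl
        rw [← this]; exact h
      have hmd : m + d ≤ n := by exact_mod_cast h'
      have hm : m ≤ n - d := by omega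
      have : ((m : ℕ∞) : WithBot ℕ∞) ≤ (((n - d : ℕ) : ℕ∞) : WithBot ℕ∞) :=
        WithBot.coe_le_coe.mpr (by exact_mod_cast hm)
      simpa only [WithBot.coe_natCast] using this

/-- **Auslander–Buchsbaum for Cohen–Macaulay quotients (the inequality).** Let `S` be a regular
local ring of dimension `n`, `S ↠ T` a surjection onto a local ring `T` of dimension `d` in which
every system of parameters is a weakly regular sequence (the tree's Cohen–Macaulay clause). Then
`pd_S T ≤ n - d`: a regular system of parameters `x₁,…,x_d` of `T` lifts to `𝔪_S`, is weakly
`T`-regular over `S`, and `pd_S (T/(x)T) = pd_S T + d ≤ gl.dim S = n`.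
[cite: BrunsHerzog1998, Thm. 1.3.3 (Auslander–Buchsbaum), Thm. 2.1.2; Matsumura1987, Thm. 19.2] -/
theorem hasProjectiveDimensionLE_of_cmClause (hφ : Function.Surjective (algebraMap S T))
    (hcm : ∀ d : ℕ, ringKrullDim T = d → ∀ s : Fin d → T,
      (Ideal.span (Set.range s)).radical.IsMaximal → IsWeaklyRegular T (List.ofFn s))
    {n d : ℕ} (hn : ringKrullDim S = n) (hd : ringKrullDim T = d) :
    HasProjectiveDimensionLE (ModuleCat.of S T) (n - d) := by
  haveI : IsNoetherianRing T := isNoetherianRing_of_surjective S T (algebraMap S T) hφ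
  haveI : Module.Finite S T := Module.Finite.of_surjective (Algebra.linearMap S T) hφ
  -- a maximal regular sequence of `T` in `𝔪_T`, of length `d`
  obtain ⟨rs, hreg, hmem, hlen⟩ := exists_isRegular_of_cmClause hcm
  have hlen' : rs.length = d := by
    rw [hd] at hlen
    exact_mod_cast hlen
  -- lift it to `S`
  obtain ⟨rs', rfl⟩ := hφ.list_map rs
  have hmem' : ∀ r ∈ rs', r ∈ maximalIdeal S := by
    intro r hr
    have h1 : algebraMap S T r ∈ maximalIdeal T := hmem _ (List.mem_map_of_mem hr)
    rw [IsLocalRing.mem_maximalIdeal, mem_nonunits_iff] at h1 ⊢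
    exact fun hu => h1 (hu.map _)
  have hreg' : IsWeaklyRegular T rs' :=
    (isWeaklyRegular_map_algebraMap_iff T T rs').mp hreg.toIsWeaklyRegular
  -- `pd (T/(x)T) = pd T + d`
  have hpd := ModuleCat.projectiveDimension_quotient_eq_add_length_of_isWeaklyRegular
    (ModuleCat.of S T) rs' hreg' hmem'
  rw [List.length_map] at hlen'
  -- `pd (T/(x)T) ≤ gl.dim S = n`
  obtain ⟨xs, hxreg, hxspan, hxlen⟩ := exists_isRegular_ofList_eq_maximalIdeal (R := S)
  have hxn : xs.length = n := by
    rw [hn] at hxlen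
    exact_mod_cast hxlen
  have hle : projectiveDimension
      (ModuleCat.of S (T ⧸ Ideal.ofList rs' • (⊤ : Submodule S T))) ≤ n := by
    rw [projectiveDimension_le_iff, ← hxn]
    exact hasProjectiveDimensionLE_length_of_isWeaklyRegular hxreg.toIsWeaklyRegular hxspan _
  rw [hpd, hlen'] at hle
  rw [← projectiveDimension_le_iff]
  exact withBot_enat_le_sub_of_add_le hle

end PdBound

/-! ## §2. At a Cohen–Macaulay point the `Ext`-annihilators avoid the prime above the codimension -/

section CMPoints

variable {B : Type u} [CommRing B] [IsDomain B] [IsRegularRing B]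
  (I : Ideal B) (𝔓 : Ideal (B ⧸ I)) [𝔓.IsPrime]

/-- **Converse of Theorem A at a point.** Let `B` be a regular Noetherian domain, `A = B/I`, `F` a
free resolution of finite type of the `B`-module `A`, `𝔓` a prime of `A` over `𝔭 = 𝔓 ∩ B`, with
`dim B_𝔭 = n'` and `dim A_𝔓 = d'`. If `A_𝔓` is Cohen–Macaulay (every system of parameters is a
weakly regular sequence) then `Ann_B E^q(F) ⊄ 𝔭` for every `q > n' - d'`: by §1,
`pd_{B_𝔭} A_𝔓 ≤ n' - d'`, so the localized syzygies `(K_{q-1})_𝔭` are projective and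
`E^q_𝔭 = 0` (`FreeResolution.annihilator_EMod_not_le`).
[cite: BrunsHerzog1998, Thm. 1.3.3, proof of Thm. 8.1.2; EGAIV2, Prop. 6.11.2 (i)] -/
theorem not_annihilator_EMod_le_of_cmClause (F : FreeResolution B (B ⧸ I))
    (hcm : ∀ d : ℕ, ringKrullDim (Localization.AtPrime 𝔓) = d →
      ∀ s : Fin d → Localization.AtPrime 𝔓, (Ideal.span (Set.range s)).radical.IsMaximal →
        IsWeaklyRegular (Localization.AtPrime 𝔓) (List.ofFn s))
    {n' d' : ℕ} (hn' : ringKrullDim (Localization.AtPrime (underPrime I 𝔓)) = n')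
    (hd' : ringKrullDim (Localization.AtPrime 𝔓) = d') {q : ℕ} (hq : n' - d' < q) :
    ¬ Module.annihilator B (F.EMod q) ≤ underPrime I 𝔓 := by
  letI := quotientLocalizationAlgebra I 𝔓
  haveI := isScalarTower_quotientLocalization I 𝔓
  haveI := finite_quotientLocalization I 𝔓
  haveI : IsRegularLocalRing (Localization.AtPrime (underPrime I 𝔓)) :=
    IsRegularRing.isRegularLocalRing_localization _
  obtain ⟨q', rfl⟩ : ∃ q', q = q' + 1 := ⟨q - 1, by omega⟩
  refine F.annihilator_EMod_not_le (underPrime I 𝔓) q' ?_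
  have hpd : HasProjectiveDimensionLE (ModuleCat.of (Localization.AtPrime (underPrime I 𝔓))
      (Localization.AtPrime 𝔓)) (n' - d') :=
    hasProjectiveDimensionLE_of_cmClause (algebraMap_quotientLocalization_surjective I 𝔓)
      hcm hn' hd'
  let e : Localization.AtPrime 𝔓 ≃ₗ[Localization.AtPrime (underPrime I 𝔓)]
      LocalizedModule (underPrime I 𝔓).primeCompl (B ⧸ I) :=
    (isBaseChange_toLocalizationLinearMap I 𝔓).equiv.symm.trans
      (FreeResolution.isBaseChange_mkLinearMap (M := B ⧸ I) (underPrime I 𝔓)).equiv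
  haveI := hpd
  have hpd' : HasProjectiveDimensionLE (ModuleCat.of (Localization.AtPrime (underPrime I 𝔓))
      (LocalizedModule (underPrime I 𝔓).primeCompl (B ⧸ I))) (n' - d') :=
    ModuleCat.hasProjectiveDimensionLE_of_linearEquiv
      (M := ModuleCat.of (Localization.AtPrime (underPrime I 𝔓)) (Localization.AtPrime 𝔓)) e _
  exact (F.localize (underPrime I 𝔓)).projective_syzygyObj_of_hasProjectiveDimensionLE hpd' q'
    (by omega)

end CMPoints

/-! ## §3. Heights: the codimension `ht 𝔭 - dim A_𝔓` along the minimal primes of `I` -/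

section Heights

/-- In a preorder, `height (p 0) + length p ≤ height (last p)` for a strict series `p`.
[folklore] -/
private theorem height_head_add_length_le_height_last {α : Type*} [Preorder α] (p : LTSeries α) :
    Order.height p.head + p.length ≤ Order.height p.last := by
  have key : ∀ i : Fin (p.length + 1), Order.height p.head + (i : ℕ) ≤ Order.height (p i) := by
    intro i
    induction i using Fin.induction with
    | zero => simp [RelSeries.head]
    | succ i ih =>
      have hstep : p i.castSucc < p i.succ := p.step i
      calc Order.height p.head + ((i.succ : ℕ) : ℕ∞)
          = Order.height p.head + ((i.castSucc : ℕ) : ℕ∞) + 1 := by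
            simp only [Fin.val_succ, Fin.val_castSucc, Nat.cast_add, Nat.cast_one, add_assoc]
        _ ≤ Order.height (p i.castSucc) + 1 := by gcongr
        _ ≤ Order.height (p i.succ) := Order.height_add_one_le hstep
  simpa [RelSeries.last] using key (Fin.last _)

variable {B : Type u} [CommRing B]

/-- `Spec(B/I) → Spec B` is strictly monotone. [folklore] -/
private theorem strictMono_comap_quotientMk (I : Ideal B) :
    StrictMono (PrimeSpectrum.comap (Ideal.Quotient.mk I)) :=
  Monotone.strictMono_of_injective (fun _ _ h => Ideal.comap_mono h)
    (PrimeSpectrum.comap_injective_of_surjective _ Ideal.Quotient.mk_surjective)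

/-- `I ⊆ 𝔮 ∩ B` for every prime `𝔮` of `B/I`. [folklore] -/
private theorem le_underPrime (I : Ideal B) (𝔔 : Ideal (B ⧸ I)) [𝔔.IsPrime] : I ≤ underPrime I 𝔔 := by
  intro x hx
  rw [Ideal.mem_comap, Ideal.Quotient.eq_zero_iff_mem.mpr hx]
  exact 𝔔.zero_mem

/-- **No catenarity needed:** for a prime `𝔓` of `A = B/I` (`B` Noetherian) over `𝔭 = 𝔓 ∩ B`
there is a minimal prime `Q` of `I` below `𝔭` with `ht_A 𝔓 + ht_B Q ≤ ht_B 𝔭` (push a maximal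
chain below `𝔓` into `Spec B` and prolong it below its bottom). [folklore] -/
private theorem exists_minimalPrimes_height_add_le [IsNoetherianRing B] (I : Ideal B)
    (𝔓 : Ideal (B ⧸ I)) [𝔓.IsPrime] :
    ∃ Q ∈ I.minimalPrimes, Q ≤ underPrime I 𝔓 ∧
      𝔓.height + Q.height ≤ (underPrime I 𝔓).height := by
  obtain ⟨l, hlast, hlen⟩ := Ideal.exists_ltSeries_length_eq_height 𝔓
  set f := PrimeSpectrum.comap (Ideal.Quotient.mk I) with hf
  let l' := l.map f (strictMono_comap_quotientMk I)
  haveI : l.head.asIdeal.IsPrime := l.head.isPrime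
  have hQ'I : I ≤ (f l.head).asIdeal := le_underPrime I l.head.asIdeal
  obtain ⟨Q, hQmin, hQle⟩ := Ideal.exists_minimalPrimes_le hQ'I
  have hheadlast : f l.head ≤ f l.last :=
    (strictMono_comap_quotientMk I).monotone (l.head_le_last)
  have hlast' : f l.last = ⟨underPrime I 𝔓, inferInstance⟩ := by
    rw [hlast]; rfl
  refine ⟨Q, hQmin, hQle.trans (by rw [hlast'] at hheadlast; exact hheadlast), ?_⟩
  have h1 := height_head_add_length_le_height_last l'
  rw [LTSeries.head_map, LTSeries.last_map, hlast'] at h1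
  have hlen' : (l'.length : ℕ∞) = 𝔓.height := by
    rw [← hlen]; rfl
  rw [hlen', ← PrimeSpectrum.height_eq_orderHeight, ← PrimeSpectrum.height_eq_orderHeight] at h1
  calc 𝔓.height + Q.height ≤ 𝔓.height + (f l.head).asIdeal.height := by
        gcongr
    _ = (f l.head).asIdeal.height + 𝔓.height := add_comm _ _
    _ ≤ (underPrime I 𝔓).height := h1

variable (k : Type u) [Field k] [IsDomain B] [Algebra k B] [Algebra.FiniteType k B] {n : ℕ}
  (hB : ringKrullDim B = n)

include k hB in
/-- **Catenarity of affine domains, relative form:** for primes `I ⊆ Q ⊆ 𝔭 = 𝔓 ∩ B` of a domain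
`B` of finite type over a field, `ht_B 𝔭 ≤ ht_B Q + ht_A 𝔓` (`A = B/I`): by the dimension
formula in `B` and in `B/Q`, `ht_{B/Q}(𝔭/Q) = ht 𝔭 - ht Q`, and `Spec(B/Q) ⊆ Spec A` below `𝔓`.
[cite: Matsumura1987, Thm. 5.6] -/
theorem height_underPrime_le_height_add (I : Ideal B) (𝔓 : Ideal (B ⧸ I)) [𝔓.IsPrime]
    (Q : Ideal B) [Q.IsPrime] (hIQ : I ≤ Q) (hQ : Q ≤ underPrime I 𝔓) :
    (underPrime I 𝔓).height ≤ Q.height + 𝔓.height := by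
  haveI : IsNoetherianRing B := Algebra.FiniteType.isNoetherianRing k B
  set 𝔭 := underPrime I 𝔓 with h𝔭def
  -- the numbers
  obtain ⟨hp, hhp⟩ := exists_height_eq k 𝔭
  obtain ⟨hq, hhq⟩ := exists_height_eq k Q
  haveI : IsDomain (B ⧸ Q) := Ideal.Quotient.isDomain Q
  haveI : IsDomain (B ⧸ 𝔭) := Ideal.Quotient.isDomain 𝔭
  obtain ⟨eq_, heq, -⟩ :=
    Literature.RingTheory.KrullDimension.exists_ringKrullDim_eq_and_trdeg_eq k (B ⧸ Q)
  obtain ⟨ep, hep, -⟩ :=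
    Literature.RingTheory.KrullDimension.exists_ringKrullDim_eq_and_trdeg_eq k (B ⧸ 𝔭)
  have hsumQ := height_add_eq_of_ringKrullDim_quotient k hB Q heq hhq
  have hsump := height_add_eq_of_ringKrullDim_quotient k hB 𝔭 hep hhp
  -- the prime `𝔭/Q` of `B/Q` and its height
  set 𝔭' : Ideal (B ⧸ Q) := 𝔭.map (Ideal.Quotient.mk Q) with h𝔭'
  haveI h𝔭'p : 𝔭'.IsPrime := Ideal.isPrime_map_quotientMk_of_isPrime hQ
  have hdimf := Literature.RingTheory.KrullDimension.ringKrullDim_quotient_add_height k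
    (A := B ⧸ Q) 𝔭'
  have hdq : ringKrullDim ((B ⧸ Q) ⧸ 𝔭') = ep := by
    rw [ringKrullDim_eq_of_ringEquiv (DoubleQuot.quotQuotEquivQuotOfLE hQ), hep]
  rw [hdq, heq] at hdimf
  obtain ⟨h', hh'⟩ := exists_height_eq k 𝔭'
  rw [hh'] at hdimf
  have hsum' : ep + h' = eq_ := by
    have : ((ep + h' : ℕ) : WithBot ℕ∞) = eq_ := by rw [← hdimf]; rfl
    exact_mod_cast this
  -- `ht_{B/Q}(𝔭/Q) ≤ ht_A 𝔓`: `Spec(B/Q) → Spec(B/I)` is strictly monotone and sends `𝔭/Q` to `𝔓`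
  let g := PrimeSpectrum.comap (Ideal.Quotient.factor hIQ)
  have hg : StrictMono g :=
    Monotone.strictMono_of_injective (fun _ _ h => Ideal.comap_mono h)
      (PrimeSpectrum.comap_injective_of_surjective _ (Ideal.Quotient.factor_surjective hIQ))
  have hg𝔭 : g ⟨𝔭', h𝔭'p⟩ = ⟨𝔓, inferInstance⟩ := by
    apply PrimeSpectrum.ext
    change 𝔭'.comap (Ideal.Quotient.factor hIQ) = 𝔓
    ext a
    obtain ⟨b, rfl⟩ := Ideal.Quotient.mk_surjective a
    rw [Ideal.mem_comap, Ideal.Quotient.factor_mk, h𝔭', Ideal.mem_quotient_iff_mem hQ, h𝔭def,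
      Ideal.mem_comap]
  have hle : 𝔭'.height ≤ 𝔓.height := by
    have := Order.height_le_height_apply_of_strictMono g hg ⟨𝔭', h𝔭'p⟩
    rw [hg𝔭, ← PrimeSpectrum.height_eq_orderHeight, ← PrimeSpectrum.height_eq_orderHeight] at this
    exact this
  -- arithmetic: `hp = n - ep`, `hq = n - eq_`, `h' = eq_ - ep = hp - hq`
  rw [hh'] at hle
  rw [hhp, hhq]
  calc (hp : ℕ∞) = hq + h' := by
        have : hp = hq + h' := by omega
        exact_mod_cast this
    _ ≤ hq + 𝔓.height := by gcongr

end Heights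

/-! ## §4. The affine heart: the Cohen–Macaulay locus of `Spec (B/I)` is open -/

section Affine

/-- For a surjection `S ↠ T`, the dimension of the support of the `S`-module `T` is `dim T`.
[folklore] -/
private theorem supportDim_eq_ringKrullDim_of_surjective {S T : Type u} [CommRing S] [CommRing T]
    [Algebra S T] (hφ : Function.Surjective (algebraMap S T)) :
    Module.supportDim S T = ringKrullDim T := by
  haveI : Module.Finite S T := Module.Finite.of_surjective (Algebra.linearMap S T) hφ
  have hann : Module.annihilator S T = RingHom.ker (algebraMap S T) := by
    ext x
    rw [Module.mem_annihilator, RingHom.mem_ker]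
    constructor
    · intro h
      simpa [Algebra.smul_def] using h 1
    · intro h t
      rw [Algebra.smul_def, h, zero_mul]
  rw [Module.supportDim_eq_ringKrullDim_quotient_annihilator, hann]
  exact ringKrullDim_eq_of_ringEquiv (RingHom.quotientKerEquivOfSurjective hφ)

variable {B : Type u} [CommRing B] (I : Ideal B)

/-- The primes `𝔓` of `B/I` with `J ⊄ 𝔓 ∩ B` form an open set (the complement of `V(J·(B/I))`).
[folklore] -/
private theorem isOpen_setOf_not_le_underPrime (J : Ideal B) :
    IsOpen {𝔓 : PrimeSpectrum (B ⧸ I) | ¬ J ≤ underPrime I 𝔓.asIdeal} := by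
  have : {𝔓 : PrimeSpectrum (B ⧸ I) | ¬ J ≤ underPrime I 𝔓.asIdeal} =
      (PrimeSpectrum.zeroLocus (J.map (Ideal.Quotient.mk I) : Set (B ⧸ I)))ᶜ := by
    ext 𝔓
    rw [Set.mem_setOf_eq, Set.mem_compl_iff, PrimeSpectrum.mem_zeroLocus, SetLike.coe_subset_coe,
      Ideal.map_le_iff_le_comap]
  rw [this]
  exact (PrimeSpectrum.isClosed_zeroLocus _).isOpen_compl

variable (k : Type u) [Field k] [IsDomain B] [Algebra k B] [Algebra.FiniteType k B] {n : ℕ}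
  (hB : ringKrullDim B = n) [IsRegularRing B]

include k hB in
/-- **The Cohen–Macaulay locus of `Spec (B/I)` is open** for a regular affine `k`-domain `B` of
dimension `n` and any ideal `I`. Fix a free resolution `F` of `A = B/I` over `B`. A prime `𝔓₀`
with `A_{𝔓₀}` Cohen–Macaulay, over `𝔭₀ = 𝔓₀ ∩ B`, with codimension `c₀ = ht 𝔭₀ - dim A_{𝔓₀}`,
has the open neighbourhood
`U = {𝔓 : E^q(F)_𝔭 = 0 for c₀ < q ≤ max n 2} ∩ {𝔓 : every minimal prime of I below 𝔭 lies below 𝔭₀}`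
(§2 puts `𝔓₀` in `U`); for `𝔓 ∈ U` the codimension `ht 𝔭 - dim A_𝔓` is at least `c₀` (§3), so the
`Ext`-annihilator ideal of `F ⊗ B_𝔭` over the window `(ht 𝔭 - dim A_𝔓, max (ht 𝔭) 2]` is the unit
ideal and `A_𝔓` is Cohen–Macaulay by Theorem A (`cmClause_of_prod_annihilator_EMod_eq_top`).
[cite: EGAIV2, Prop. 6.11.2, Cor. 6.11.3; BrunsHerzog1998, Thm. 2.1.2, proof of Thm. 8.1.2] -/
theorem isOpen_setOf_cmClause_quotient :
    IsOpen {𝔓 : PrimeSpectrum (B ⧸ I) | ∀ d : ℕ,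
      ringKrullDim (Localization.AtPrime 𝔓.asIdeal) = d →
        ∀ s : Fin d → Localization.AtPrime 𝔓.asIdeal, (Ideal.span (Set.range s)).radical.IsMaximal →
          IsWeaklyRegular (Localization.AtPrime 𝔓.asIdeal) (List.ofFn s)} := by
  haveI : IsNoetherianRing B := Algebra.FiniteType.isNoetherianRing k B
  obtain ⟨F⟩ := (inferInstance : Nonempty (FreeResolution B (B ⧸ I)))
  rw [isOpen_iff_forall_mem_open]
  intro 𝔓₀ h𝔓₀
  -- the numbers at `𝔓₀`
  set 𝔭₀ := underPrime I 𝔓₀.asIdeal with h𝔭₀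
  obtain ⟨n₀, hn₀⟩ := exists_height_eq k 𝔭₀
  obtain ⟨d₀, hd₀⟩ := exists_height_eq k 𝔓₀.asIdeal
  have hn₀' : ringKrullDim (Localization.AtPrime 𝔭₀) = n₀ := by
    rw [IsLocalization.AtPrime.ringKrullDim_eq_height 𝔭₀ (Localization.AtPrime 𝔭₀), hn₀]; rfl
  have hd₀' : ringKrullDim (Localization.AtPrime 𝔓₀.asIdeal) = d₀ := by
    rw [IsLocalization.AtPrime.ringKrullDim_eq_height 𝔓₀.asIdeal
      (Localization.AtPrime 𝔓₀.asIdeal), hd₀]; rfl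
  -- the neighbourhood
  set T : Set (Ideal B) := {Q | Q ∈ I.minimalPrimes ∧ ¬ Q ≤ 𝔭₀} with hT
  have hTfin : T.Finite :=
    (I.finite_minimalPrimes_of_isNoetherianRing B).subset (fun Q hQ => hQ.1)
  set U : Set (PrimeSpectrum (B ⧸ I)) :=
    (⋂ q ∈ Finset.Ioc (n₀ - d₀) (max n 2),
      {𝔓 | ¬ Module.annihilator B (F.EMod q) ≤ underPrime I 𝔓.asIdeal}) ∩
    (⋂ Q ∈ T, {𝔓 | ¬ Q ≤ underPrime I 𝔓.asIdeal}) with hU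
  refine ⟨U, ?_, ?_, ?_⟩
  · -- `U ⊆` Cohen–Macaulay locus
    intro 𝔓 h𝔓
    rw [hU, Set.mem_inter_iff, Set.mem_iInter₂, Set.mem_iInter₂] at h𝔓
    obtain ⟨h𝔓1, h𝔓2⟩ := h𝔓
    simp only [Finset.mem_Ioc, Set.mem_setOf_eq, and_imp] at h𝔓1 h𝔓2
    set 𝔭 := underPrime I 𝔓.asIdeal with h𝔭
    letI := quotientLocalizationAlgebra I 𝔓.asIdeal
    haveI := isScalarTower_quotientLocalization I 𝔓.asIdeal
    haveI := finite_quotientLocalization I 𝔓.asIdeal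
    haveI : IsRegularLocalRing (Localization.AtPrime 𝔭) :=
      IsRegularRing.isRegularLocalRing_localization _
    -- numbers at `𝔓`
    obtain ⟨n', hn'⟩ := exists_height_eq k 𝔭
    obtain ⟨d', hd'⟩ := exists_height_eq k 𝔓.asIdeal
    have hn'' : ringKrullDim (Localization.AtPrime 𝔭) = n' := by
      rw [IsLocalization.AtPrime.ringKrullDim_eq_height 𝔭 (Localization.AtPrime 𝔭), hn']; rfl
    have hd'' : ringKrullDim (Localization.AtPrime 𝔓.asIdeal) = d' := by
      rw [IsLocalization.AtPrime.ringKrullDim_eq_height 𝔓.asIdeal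
        (Localization.AtPrime 𝔓.asIdeal), hd']; rfl
    have hsupp : Module.supportDim (Localization.AtPrime 𝔭) (Localization.AtPrime 𝔓.asIdeal) = d' := by
      rw [supportDim_eq_ringKrullDim_of_surjective
        (algebraMap_quotientLocalization_surjective I 𝔓.asIdeal), hd'']
    -- `n' ≤ n`
    have hn'le : n' ≤ n := by
      have h1 := Ideal.height_le_ringKrullDim_of_ne_top (Ideal.IsPrime.ne_top (inferInstance : 𝔭.IsPrime))
      rw [hn', hB] at h1
      exact_mod_cast h1
    -- the codimension at `𝔓` is at least `c₀ = n₀ - d₀`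
    have hcodim : n₀ - d₀ ≤ n' - d' := by
      obtain ⟨Q, hQmin, hQle, hQh⟩ := exists_minimalPrimes_height_add_le I 𝔓.asIdeal
      haveI : Q.IsPrime := hQmin.1.1
      obtain ⟨hq, hhq⟩ := exists_height_eq k Q
      -- `Q ≤ 𝔭₀`, else `𝔓 ∉ U`
      have hQ𝔭₀ : Q ≤ 𝔭₀ := by
        by_contra hQ
        exact h𝔓2 Q ⟨hQmin, hQ⟩ hQle
      have h1 : d' + hq ≤ n' := by
        rw [hd', hhq, hn'] at hQh
        exact_mod_cast hQh
      have h2 := height_underPrime_le_height_add k hB I 𝔓₀.asIdeal Q hQmin.1.2 hQ𝔭₀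
      rw [hn₀, hhq, hd₀] at h2
      have h2' : n₀ ≤ hq + d₀ := by exact_mod_cast h2
      omega
    -- the `Ext`-annihilator ideal of `F ⊗ B_𝔭` over the local window is the unit ideal
    have hprod : ¬ (∏ q ∈ Finset.Ioc (n' - d') (max n' 2), Module.annihilator B (F.EMod q)) ≤ 𝔭 := by
      intro hle
      obtain ⟨q, hq, hq'⟩ := (Ideal.IsPrime.prod_le inferInstance).mp hle
      rw [Finset.mem_Ioc] at hq
      refine h𝔓1 q (by omega) ?_ hq'
      calc q ≤ max n' 2 := hq.2
        _ ≤ max n 2 := max_le_max hn'le le_rfl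
    have hmaptop : (∏ q ∈ Finset.Ioc (n' - d') (max n' 2),
        Module.annihilator B (F.EMod q)).map (algebraMap B (Localization.AtPrime 𝔭)) = ⊤ := by
      obtain ⟨z, hz, hz𝔭⟩ := SetLike.not_le_iff_exists.mp hprod
      exact Ideal.eq_top_of_isUnit_mem _ (Ideal.mem_map_of_mem _ hz)
        (IsLocalization.map_units _ (⟨z, hz𝔭⟩ : 𝔭.primeCompl))
    have h3 := map_prod_annihilator_EMod_le_quotientLocalize I 𝔓.asIdeal F
      (Finset.Ioc (n' - d') (max n' 2)) (fun q hq => one_le_of_mem_Ioc hq)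
    have htop := top_le_iff.mp (hmaptop.symm.le.trans h3)
    exact cmClause_of_prod_annihilator_EMod_eq_top
      (algebraMap_quotientLocalization_surjective I 𝔓.asIdeal) (F.quotientLocalize I 𝔓.asIdeal)
      hn'' hsupp htop
  · -- `U` is open
    rw [hU]
    refine IsOpen.inter (isOpen_biInter_finset fun q _ => isOpen_setOf_not_le_underPrime I _)
      (hTfin.isOpen_biInter fun Q _ => isOpen_setOf_not_le_underPrime I Q)
  · -- `𝔓₀ ∈ U`
    rw [hU, Set.mem_inter_iff, Set.mem_iInter₂, Set.mem_iInter₂]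
    refine ⟨fun q hq => ?_, fun Q hQ => ?_⟩
    · rw [Finset.mem_Ioc] at hq
      exact not_annihilator_EMod_le_of_cmClause I 𝔓₀.asIdeal F h𝔓₀ hn₀' hd₀' hq.1
    · exact hQ.2

end Affine

/-! ## §5. Any algebra of finite type over a field; schemes locally of finite type over a field -/

section FiniteType

/-- **The Cohen–Macaulay locus of `Spec A` is open for `A` of finite type over a field `k`**:
present `A ≅ k[x₁,…,xₙ]/I` and transport `isOpen_setOf_cmClause_quotient` along the homeomorphism
`Spec A ≅ Spec k[x]/I` (the local rings at corresponding primes are isomorphic).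
[cite: EGAIV2, Cor. 6.11.3 with (5.8.3)] -/
theorem isOpen_setOf_cmClause (k A : Type u) [Field k] [CommRing A] [Algebra k A]
    [Algebra.FiniteType k A] :
    IsOpen {𝔓 : PrimeSpectrum A | ∀ d : ℕ,
      ringKrullDim (Localization.AtPrime 𝔓.asIdeal) = d →
        ∀ s : Fin d → Localization.AtPrime 𝔓.asIdeal, (Ideal.span (Set.range s)).radical.IsMaximal →
          IsWeaklyRegular (Localization.AtPrime 𝔓.asIdeal) (List.ofFn s)} := by
  obtain ⟨n, f, hf⟩ := Algebra.FiniteType.iff_quotient_mvPolynomial''.mp ‹Algebra.FiniteType k A›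
  set I := RingHom.ker f with hI
  let e : (MvPolynomial (Fin n) k ⧸ I) ≃+* A :=
    (Ideal.quotientKerAlgEquivOfSurjective hf).toRingEquiv
  haveI : IsRegularRing (MvPolynomial (Fin n) k) := inferInstance
  have hopen := isOpen_setOf_cmClause_quotient I k (ringKrullDim_mvPolynomial_fin_eq k n)
  -- local rings at corresponding primes
  have key : ∀ 𝔓 : PrimeSpectrum A,
      Nonempty (Localization.AtPrime (𝔓.asIdeal.comap (e : (MvPolynomial (Fin n) k ⧸ I) →+* A)) ≃+*
        Localization.AtPrime 𝔓.asIdeal) := fun 𝔓 =>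
    ⟨IsLocalization.ringEquivOfRingEquiv
      (M := (𝔓.asIdeal.comap (e : (MvPolynomial (Fin n) k ⧸ I) →+* A)).primeCompl)
      (T := 𝔓.asIdeal.primeCompl)
      (Localization.AtPrime (𝔓.asIdeal.comap (e : (MvPolynomial (Fin n) k ⧸ I) →+* A)))
      (Localization.AtPrime 𝔓.asIdeal) e (map_primeCompl_comap_ringEquiv e 𝔓.asIdeal)⟩
  have heq : {𝔓 : PrimeSpectrum A | ∀ d : ℕ,
      ringKrullDim (Localization.AtPrime 𝔓.asIdeal) = d →
        ∀ s : Fin d → Localization.AtPrime 𝔓.asIdeal, (Ideal.span (Set.range s)).radical.IsMaximal →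
          IsWeaklyRegular (Localization.AtPrime 𝔓.asIdeal) (List.ofFn s)} =
      PrimeSpectrum.comap (e : (MvPolynomial (Fin n) k ⧸ I) →+* A) ⁻¹'
        {𝔔 : PrimeSpectrum (MvPolynomial (Fin n) k ⧸ I) | ∀ d : ℕ,
          ringKrullDim (Localization.AtPrime 𝔔.asIdeal) = d →
            ∀ s : Fin d → Localization.AtPrime 𝔔.asIdeal,
              (Ideal.span (Set.range s)).radical.IsMaximal →
                IsWeaklyRegular (Localization.AtPrime 𝔔.asIdeal) (List.ofFn s)} := by
    ext 𝔓
    obtain ⟨e₁⟩ := key 𝔓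
    simp only [Set.mem_setOf_eq, Set.mem_preimage, PrimeSpectrum.comap_asIdeal]
    exact ⟨fun h => cmClause_of_ringEquiv (A := Localization.AtPrime 𝔓.asIdeal)
        (B := Localization.AtPrime
          (𝔓.asIdeal.comap (e : (MvPolynomial (Fin n) k ⧸ I) →+* A))) e₁.symm h,
      fun h => cmClause_of_ringEquiv
        (A := Localization.AtPrime
          (𝔓.asIdeal.comap (e : (MvPolynomial (Fin n) k ⧸ I) →+* A)))
        (B := Localization.AtPrime 𝔓.asIdeal) e₁ h⟩
  rw [heq]
  exact hopen.preimage (PrimeSpectrum.continuous_comap _)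

end FiniteType

section Schemes

open _root_.AlgebraicGeometry _root_.TopologicalSpace

/-- **EGA IV₂ Cor. 6.11.3 for `𝓕 = 𝒪_X`, `X` locally of finite type over a field: the
Cohen–Macaulay locus is open** (the statement of the named fact
`EGAIV2_cohenMacaulayLocusOpen`). Reduction to `isOpen_setOf_cmClause`: around a point take an
affine open `U = Spec Γ(X, U)`, of finite type over `k`; the local rings of `X` at the points of
`U` are the localizations of `Γ(X, U)` (`IsAffineOpen.isLocalization_stalk`), and
`U ≅ Spec Γ(X, U)` is a homeomorphism (`IsAffineOpen.isoSpec`). [cite: EGAIV2, Cor. 6.11.3] -/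
theorem EGAIV2_cohenMacaulayLocusOpen_proof (k : Type u) [Field k] (X : Scheme.{u})
    (f : X ⟶ Spec (.of k)) (hf : LocallyOfFiniteType f) :
    IsOpen {x : X | ∀ d : ℕ, ringKrullDim (X.presheaf.stalk x) = d →
      ∀ s : Fin d → X.presheaf.stalk x, (Ideal.span (Set.range s)).radical.IsMaximal →
        IsWeaklyRegular (X.presheaf.stalk x) (List.ofFn s)} := by
  rw [isOpen_iff_forall_mem_open]
  intro x hx
  obtain ⟨U, hU, hxU, -⟩ := exists_isAffineOpen_mem_and_subset (X := X) (x := x) (U := ⊤) trivial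
  -- `Γ(X, U)` is of finite type over `k`
  have hft : (f.appLE ⊤ U le_top).hom.FiniteType :=
    HasRingHomProperty.appLE (P := @LocallyOfFiniteType) f hf ⟨⊤, isAffineOpen_top _⟩ ⟨U, hU⟩
      le_top
  let α : k →+* Γ(X, U) := (f.appLE ⊤ U le_top).hom.comp (Scheme.ΓSpecIso (.of k)).inv.hom
  have hα : α.FiniteType :=
    hft.comp (RingHom.FiniteType.of_surjective _
      (Scheme.ΓSpecIso (.of k)).symm.commRingCatIsoToRingEquiv.surjective)
  letI : Algebra k Γ(X, U) := α.toAlgebra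
  haveI : Algebra.FiniteType k Γ(X, U) := hα
  have hopen := isOpen_setOf_cmClause k Γ(X, U)
  -- on `U`, the Cohen–Macaulay locus is the preimage of the affine one under `U ≅ Spec Γ(X, U)`
  set W : Set U := {y : U | ∀ d : ℕ, ringKrullDim (X.presheaf.stalk y.1) = d →
      ∀ s : Fin d → X.presheaf.stalk y.1, (Ideal.span (Set.range s)).radical.IsMaximal →
        IsWeaklyRegular (X.presheaf.stalk y.1) (List.ofFn s)} with hWdef
  have hW : IsOpen W := by
    have heq : W = (fun y : U => hU.primeIdealOf y) ⁻¹'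
        {𝔓 : PrimeSpectrum Γ(X, U) | ∀ d : ℕ,
          ringKrullDim (Localization.AtPrime 𝔓.asIdeal) = d →
            ∀ s : Fin d → Localization.AtPrime 𝔓.asIdeal,
              (Ideal.span (Set.range s)).radical.IsMaximal →
                IsWeaklyRegular (Localization.AtPrime 𝔓.asIdeal) (List.ofFn s)} := by
      ext y
      letI := X.presheaf.algebra_section_stalk y
      haveI := hU.isLocalization_stalk y
      let e₁ := (IsLocalization.algEquiv (hU.primeIdealOf y).asIdeal.primeCompl
        (Localization.AtPrime (hU.primeIdealOf y).asIdeal) (X.presheaf.stalk y.1)).toRingEquiv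
      simp only [hWdef]
      exact ⟨fun h => cmClause_of_ringEquiv (A := X.presheaf.stalk y.1)
          (B := Localization.AtPrime (hU.primeIdealOf y).asIdeal) e₁.symm h,
        fun h => cmClause_of_ringEquiv (A := Localization.AtPrime (hU.primeIdealOf y).asIdeal)
          (B := X.presheaf.stalk y.1) e₁ h⟩
    rw [heq]
    exact hopen.preimage hU.isoSpec.hom.continuous
  refine ⟨((↑) : U → X) '' W, ?_, U.isOpenEmbedding'.isOpenMap _ hW, ⟨⟨x, hxU⟩, hx, rfl⟩⟩
  rintro _ ⟨y, hy, rfl⟩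
  exact hy

end Schemes

end Literature.AlgebraicGeometry.Resolution

end
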